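import Mathlib
import Summits.ValiantsHypothesis.ValiantsHypothesis.Theorems.RigidityForcesSymmetryRankRigidMinimalReprLaplaceFiveSeparatedCaptureJointProlongation

/-!
# ValiantsHypothesis / RigidityForcesSymmetry — crux `LaplaceOptimalFive` (stmt-ValiantsHypothesis-24813), symmetric capture (SC):
# ★ **THE KERNEL SLICE: a common kernel vector of ONE span forces the corresponding slice of every obligation into the joint span**,
# and ★★ `(SC)` WHENEVER ONE SPAN HAS A FULLY SUPPORTED COMMON KERNEL VECTOR (e.g. quadrics in ≤ 4 general linear forms)

From the joint-prolongation residue (✓ `sub_symPlaced_mem_prolong`): `P₅⌞μ = 3·Sym(C) + G`, `G ∈ prolong X`, `X = U₀₁ ⊔ U₀₂ ⊔ U₁₂`.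
Contracting the last slot with a vector `z` killed by every matrix of `U₁₂` (`x z = 0` for `x ∈ U₁₂`) leaves `Σ_r z_r C_r + Σ_r z_r G_r ∈ X`:
the `z`-SLICE `(p,q) ↦ Σ_r z_r (P₅⌞μ)(p,q,r)` lies in `X` (`sliceKer_mem_12/_02/_01`).  When all coordinates of `z` are non-zero the
`z`-slice is injective on obligations (`eq_zero_of_sliceZ`: rescaling `μ_{st} ↦ μ_{st}·∏_{c ∉ {s,t}} z_c` turns the `z`-slice into the hub
contraction of ✓ `hub_injective`), whence ★★ `finrank_le_of_kernel_vector_12/_02/_01`: `finrank W ≤ finrank (U₀₁ ⊔ U₀₂ ⊔ U₁₂) ≤ Σ finrank`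
— `CaptureIneqSym` for every triple in which ONE span consists of quadrics with a common kernel vector off the coordinate
hyperplanes (e.g. any span of quadrics in ≤ 4 linear forms whose span contains no coordinate form), all dimensions, all positions.
Complementary to ✓ `captureIneqSym_of_prolong_eq_bot` (prolongation-free joint span) and to the coordinate slices of ✓ `…CoordSlices`
(kernel vectors ON the coordinate axes).

Honest framing.  A family of an OPEN inequality: `CaptureIneqSym` in general, K1 on `K₃ ⊔ K₂`, S2′, `LaplaceOptimalFive` (stmt-24813,
OPEN · CONTESTED 72/120), `RankRigidMinimalRepr`, `VP ≠ VNP` are NOT proved.  No definitions, no `sorry`; Mathlib + tree only.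
-/

set_option linter.dupNamespace false
set_option autoImplicit false

namespace Summit.ValiantsHypothesis.ValiantsHypothesis.Theorems.RigidityForcesSymmetryRankRigidMinimalRepr

namespace LaplaceFiveSeparatedCapture

open Finset LaplaceFiveSectorSplit

/-! ### Rescaling an obligation: the `z`-slice versus the hub contraction -/

/-- For five distinct letters, the product of `z` over the complement of `{s, t}` is `z_p z_q z_r`. [folklore] -/
theorem prod_sdiff_pair_of_nodup (z : Fin 5 → ℂ) (p q r s t : Fin 5) (h : [p, q, r, s, t].Nodup) :
    ∏ c ∈ Finset.univ \ {s, t}, z c = z p * z q * z r := by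
  simp only [List.nodup_cons, List.mem_cons, not_or, List.not_mem_nil, not_false_eq_true,
    List.nodup_nil, and_true] at h
  obtain ⟨⟨hpq, hpr, hps, hpt⟩, ⟨hqr, hqs, hqt⟩, ⟨hrs, hrt⟩, hst⟩ := h
  have hset : Finset.univ \ ({s, t} : Finset (Fin 5)) = {p, q, r} := by
    ext c
    simp only [Finset.mem_sdiff, Finset.mem_univ, true_and, Finset.mem_insert, Finset.mem_singleton, not_or]
    constructor
    · rintro ⟨hcs, hct⟩
      by_contra hc
      simp only [not_or] at hc
      obtain ⟨hcp, hcq, hcr⟩ := hc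
      have h6 : ({c, p, q, r, s, t} : Finset (Fin 5)).card = 6 := by
        rw [Finset.card_insert_of_notMem, Finset.card_insert_of_notMem, Finset.card_insert_of_notMem,
          Finset.card_insert_of_notMem, Finset.card_insert_of_notMem, Finset.card_singleton]
        · simpa using hst
        · simp only [Finset.mem_insert, Finset.mem_singleton, not_or]; exact ⟨hrs, hrt⟩
        · simp only [Finset.mem_insert, Finset.mem_singleton, not_or]; exact ⟨hqr, hqs, hqt⟩
        · simp only [Finset.mem_insert, Finset.mem_singleton, not_or]; exact ⟨hpq, hpr, hps, hpt⟩
        · simp only [Finset.mem_insert, Finset.mem_singleton, not_or]; exact ⟨hcp, hcq, hcr, hcs, hct⟩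
      have h5 := Finset.card_le_univ ({c, p, q, r, s, t} : Finset (Fin 5))
      rw [h6, Fintype.card_fin] at h5
      omega
    · rintro (rfl | rfl | rfl)
      · exact ⟨hps, hpt⟩
      · exact ⟨hqs, hqt⟩
      · exact ⟨hrs, hrt⟩
  rw [hset, Finset.prod_insert (by simp [hpq, hpr]), Finset.prod_insert (by simp [hqr]), Finset.prod_singleton]
  ring

/-- RESCALING: the obligation of `μ'_{st} = μ_{st} · ∏_{c ∉ {s,t}} z_c` is `z_p z_q z_r` times the obligation of `μ`. [folklore] -/
theorem contractZ_rescale (μ : Fin 5 → Fin 5 → ℂ) (z : Fin 5 → ℂ) (p q r : Fin 5) :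
    contractZ (fun s t => μ s t * ∏ c ∈ Finset.univ \ {s, t}, z c) p q r = z p * z q * z r * contractZ μ p q r := by
  unfold contractZ
  rw [Finset.mul_sum]
  refine Finset.sum_congr rfl fun s _ => ?_
  rw [Finset.mul_sum]
  refine Finset.sum_congr rfl fun t _ => ?_
  rw [perm5_word]
  by_cases h : [p, q, r, s, t].Nodup
  · rw [if_pos h]
    show μ s t * (∏ c ∈ Finset.univ \ {s, t}, z c) * 1 = z p * z q * z r * (μ s t * 1)
    rw [prod_sdiff_pair_of_nodup z p q r s t h]; ring
  · rw [if_neg h]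
    show μ s t * (∏ c ∈ Finset.univ \ {s, t}, z c) * 0 = z p * z q * z r * (μ s t * 0)
    ring

/-- ★ **THE `z`-SLICE IS INJECTIVE ON OBLIGATIONS** when every coordinate of `z` is non-zero: a symmetric zero-diagonal `μ` with
`Σ_r z_r (P₅⌞μ)(p,q,r) = 0` for all `p, q` vanishes (rescale and apply ✓ `hub_injective`). [folklore] -/
theorem eq_zero_of_sliceZ (μ : Fin 5 → Fin 5 → ℂ) (hs : ∀ s t, μ s t = μ t s) (hd : ∀ s, μ s s = 0)
    (z : Fin 5 → ℂ) (hz : ∀ c, z c ≠ 0) (h : ∀ p q : Fin 5, (∑ r : Fin 5, z r * contractZ μ p q r) = 0) : μ = 0 := by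
  let μ' : Fin 5 → Fin 5 → ℂ := fun s t => μ s t * ∏ c ∈ Finset.univ \ {s, t}, z c
  have hs' : ∀ s t, μ' s t = μ' t s := fun s t => by
    show μ s t * ∏ c ∈ Finset.univ \ {s, t}, z c = μ t s * ∏ c ∈ Finset.univ \ {t, s}, z c
    rw [hs s t, Finset.pair_comm]
  have hd' : ∀ s, μ' s s = 0 := fun s => by
    show μ s s * _ = 0
    rw [hd s, zero_mul]
  have h0 : μ' = 0 := by
    refine hub_injective μ' hs' hd' fun p q => ?_
    have e : (∑ r : Fin 5, contractZ μ' p q r) = z p * z q * ∑ r : Fin 5, z r * contractZ μ p q r := by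
      rw [Finset.mul_sum]
      refine Finset.sum_congr rfl fun r _ => ?_
      rw [contractZ_rescale]; ring
    rw [e, h p q, mul_zero]
  funext s t
  have hst := congrFun (congrFun h0 s) t
  have hprod : ∏ c ∈ Finset.univ \ {s, t}, z c ≠ 0 := Finset.prod_ne_zero_iff.mpr fun c _ => hz c
  have : μ s t * ∏ c ∈ Finset.univ \ {s, t}, z c = 0 := hst
  rcases mul_eq_zero.mp this with h1 | h1
  · exact h1
  · exact absurd h1 hprod

/-! ### The kernel slice lies in the joint span -/

/-- A contraction of an element of the prolongation lies in the space. [folklore] -/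
theorem sliceZ_mem_of_mem_prolong (X : Submodule ℂ (Fin 5 → Fin 5 → ℂ)) {G : Fin 5 → Fin 5 → Fin 5 → ℂ}
    (hG : G ∈ prolong X) (z : Fin 5 → ℂ) : (fun p q => ∑ r : Fin 5, z r * G p q r) ∈ X := by
  obtain ⟨h12, h23, hsl⟩ := (mem_prolong_iff X G).mp hG
  have e : (fun p q => ∑ r : Fin 5, z r * G p q r) = ∑ r : Fin 5, z r • G r := by
    funext p q
    simp only [Finset.sum_apply, Pi.smul_apply, smul_eq_mul]
    refine Finset.sum_congr rfl fun r _ => ?_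
    rw [h23 p q r, h12 p r q]
  rw [e]
  exact Submodule.sum_mem _ fun r _ => Submodule.smul_mem _ _ (hsl r)

/-- ★ **KERNEL SLICE, slot `12`.**  If `z` is a common kernel vector of `U₁₂` (`Σ_r x(q,r) z_r = 0` for every `x ∈ U₁₂` and every row `q`),
then the `z`-slice of every obligation captured by `L3 U₀₁ U₀₂ U₁₂` lies in `U₀₁ ⊔ U₀₂ ⊔ U₁₂`. [folklore] -/
theorem sliceKer_mem_12 (U01 U02 U12 : Submodule ℂ (Fin 5 → Fin 5 → ℂ))
    (h01 : ∀ x ∈ U01, ∀ p q : Fin 5, x p q = x q p) (h02 : ∀ x ∈ U02, ∀ p q : Fin 5, x p q = x q p)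
    (h12 : ∀ x ∈ U12, ∀ p q : Fin 5, x p q = x q p) (z : Fin 5 → ℂ)
    (hker : ∀ x ∈ U12, ∀ q : Fin 5, (∑ r : Fin 5, x q r * z r) = 0)
    (μ : Fin 5 → Fin 5 → ℂ) (hμ : contractZ μ ∈ L3 U01 U02 U12) :
    (fun p q => ∑ r : Fin 5, z r * contractZ μ p q r) ∈ U01 ⊔ U02 ⊔ U12 := by
  obtain ⟨A, B, C, hA, hB, hC, hT⟩ := L3_finite_form U01 U02 U12 hμ
  have hres := (sub_symPlaced_mem_prolong U01 U02 U12 A B C (contractZ μ) hA hB hC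
    (fun r p q => h01 _ (hA r) p q) (fun r p q => h02 _ (hB r) p q) (fun r p q => h12 _ (hC r) p q) hT
    (fun p q r => contractZ_swap12 μ p q r) (fun p q r => contractZ_swap23 μ p q r)).1
  have hsl := sliceZ_mem_of_mem_prolong _ hres z
  have hk : ∀ a b : Fin 5, (∑ r : Fin 5, z r * C a b r) = 0 := fun a b => by
    have := hker (C a) (hC a) b
    rw [← this]
    exact Finset.sum_congr rfl fun r _ => by ring
  have e : (fun p q => ∑ r : Fin 5, z r * contractZ μ p q r)
      = (fun p q => ∑ r : Fin 5, z r * (contractZ μ - fun p q r => C r p q + C q p r + C p q r) p q r)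
        + ∑ r : Fin 5, z r • C r := by
    funext p q
    simp only [Pi.add_apply, Pi.sub_apply, Finset.sum_apply, Pi.smul_apply, smul_eq_mul]
    have e1 : (∑ r : Fin 5, z r * (contractZ μ p q r - (C r p q + C q p r + C p q r)))
        = (∑ r : Fin 5, z r * contractZ μ p q r) - (∑ r : Fin 5, z r * C r p q)
          - (∑ r : Fin 5, z r * C q p r) - (∑ r : Fin 5, z r * C p q r) := by
      rw [← Finset.sum_sub_distrib, ← Finset.sum_sub_distrib, ← Finset.sum_sub_distrib]
      exact Finset.sum_congr rfl fun r _ => by ring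
    rw [e1, hk q p, hk p q]
    ring
  rw [e]
  exact Submodule.add_mem _ hsl (Submodule.sum_mem _ fun r _ => Submodule.smul_mem _ _ (Submodule.mem_sup_right (hC r)))

/-- ★ **KERNEL SLICE, slot `02`.** [folklore] -/
theorem sliceKer_mem_02 (U01 U02 U12 : Submodule ℂ (Fin 5 → Fin 5 → ℂ))
    (h01 : ∀ x ∈ U01, ∀ p q : Fin 5, x p q = x q p) (h02 : ∀ x ∈ U02, ∀ p q : Fin 5, x p q = x q p)
    (h12 : ∀ x ∈ U12, ∀ p q : Fin 5, x p q = x q p) (z : Fin 5 → ℂ)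
    (hker : ∀ x ∈ U02, ∀ q : Fin 5, (∑ r : Fin 5, x q r * z r) = 0)
    (μ : Fin 5 → Fin 5 → ℂ) (hμ : contractZ μ ∈ L3 U01 U02 U12) :
    (fun p q => ∑ r : Fin 5, z r * contractZ μ p q r) ∈ U01 ⊔ U02 ⊔ U12 := by
  obtain ⟨A, B, C, hA, hB, hC, hT⟩ := L3_finite_form U01 U02 U12 hμ
  have hres := (sub_symPlaced_mem_prolong U01 U02 U12 A B C (contractZ μ) hA hB hC
    (fun r p q => h01 _ (hA r) p q) (fun r p q => h02 _ (hB r) p q) (fun r p q => h12 _ (hC r) p q) hT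
    (fun p q r => contractZ_swap12 μ p q r) (fun p q r => contractZ_swap23 μ p q r)).2.1
  have hsl := sliceZ_mem_of_mem_prolong _ hres z
  have hk : ∀ a b : Fin 5, (∑ r : Fin 5, z r * B a b r) = 0 := fun a b => by
    have := hker (B a) (hB a) b
    rw [← this]
    exact Finset.sum_congr rfl fun r _ => by ring
  have e : (fun p q => ∑ r : Fin 5, z r * contractZ μ p q r)
      = (fun p q => ∑ r : Fin 5, z r * (contractZ μ - fun p q r => B r p q + B q p r + B p q r) p q r)
        + ∑ r : Fin 5, z r • B r := by
    funext p q
    simp only [Pi.add_apply, Pi.sub_apply, Finset.sum_apply, Pi.smul_apply, smul_eq_mul]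
    have e1 : (∑ r : Fin 5, z r * (contractZ μ p q r - (B r p q + B q p r + B p q r)))
        = (∑ r : Fin 5, z r * contractZ μ p q r) - (∑ r : Fin 5, z r * B r p q)
          - (∑ r : Fin 5, z r * B q p r) - (∑ r : Fin 5, z r * B p q r) := by
      rw [← Finset.sum_sub_distrib, ← Finset.sum_sub_distrib, ← Finset.sum_sub_distrib]
      exact Finset.sum_congr rfl fun r _ => by ring
    rw [e1, hk q p, hk p q]
    ring
  rw [e]
  exact Submodule.add_mem _ hsl (Submodule.sum_mem _ fun r _ => Submodule.smul_mem _ _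
    (Submodule.mem_sup_left (Submodule.mem_sup_right (hB r))))

/-- ★ **KERNEL SLICE, slot `01`.** [folklore] -/
theorem sliceKer_mem_01 (U01 U02 U12 : Submodule ℂ (Fin 5 → Fin 5 → ℂ))
    (h01 : ∀ x ∈ U01, ∀ p q : Fin 5, x p q = x q p) (h02 : ∀ x ∈ U02, ∀ p q : Fin 5, x p q = x q p)
    (h12 : ∀ x ∈ U12, ∀ p q : Fin 5, x p q = x q p) (z : Fin 5 → ℂ)
    (hker : ∀ x ∈ U01, ∀ q : Fin 5, (∑ r : Fin 5, x q r * z r) = 0)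
    (μ : Fin 5 → Fin 5 → ℂ) (hμ : contractZ μ ∈ L3 U01 U02 U12) :
    (fun p q => ∑ r : Fin 5, z r * contractZ μ p q r) ∈ U01 ⊔ U02 ⊔ U12 := by
  obtain ⟨A, B, C, hA, hB, hC, hT⟩ := L3_finite_form U01 U02 U12 hμ
  have hres := (sub_symPlaced_mem_prolong U01 U02 U12 A B C (contractZ μ) hA hB hC
    (fun r p q => h01 _ (hA r) p q) (fun r p q => h02 _ (hB r) p q) (fun r p q => h12 _ (hC r) p q) hT
    (fun p q r => contractZ_swap12 μ p q r) (fun p q r => contractZ_swap23 μ p q r)).2.2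
  have hsl := sliceZ_mem_of_mem_prolong _ hres z
  have hk : ∀ a b : Fin 5, (∑ r : Fin 5, z r * A a b r) = 0 := fun a b => by
    have := hker (A a) (hA a) b
    rw [← this]
    exact Finset.sum_congr rfl fun r _ => by ring
  have e : (fun p q => ∑ r : Fin 5, z r * contractZ μ p q r)
      = (fun p q => ∑ r : Fin 5, z r * (contractZ μ - fun p q r => A r p q + A q p r + A p q r) p q r)
        + ∑ r : Fin 5, z r • A r := by
    funext p q
    simp only [Pi.add_apply, Pi.sub_apply, Finset.sum_apply, Pi.smul_apply, smul_eq_mul]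
    have e1 : (∑ r : Fin 5, z r * (contractZ μ p q r - (A r p q + A q p r + A p q r)))
        = (∑ r : Fin 5, z r * contractZ μ p q r) - (∑ r : Fin 5, z r * A r p q)
          - (∑ r : Fin 5, z r * A q p r) - (∑ r : Fin 5, z r * A p q r) := by
      rw [← Finset.sum_sub_distrib, ← Finset.sum_sub_distrib, ← Finset.sum_sub_distrib]
      exact Finset.sum_congr rfl fun r _ => by ring
    rw [e1, hk q p, hk p q]
    ring
  rw [e]
  exact Submodule.add_mem _ hsl (Submodule.sum_mem _ fun r _ => Submodule.smul_mem _ _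
    (Submodule.mem_sup_left (Submodule.mem_sup_left (hA r))))

/-! ### Counting with the injective kernel slice -/

/-- **COUNT.**  If the `z`-slice of every obligation of `W` lies in a subspace `Y` and all coordinates of `z` are non-zero, then
`finrank W ≤ finrank Y`. [folklore] -/
theorem finrank_le_of_sliceZ_mem (W Y : Submodule ℂ (Fin 5 → Fin 5 → ℂ))
    (hWs : ∀ μ ∈ W, ∀ s t : Fin 5, μ s t = μ t s) (hWd : ∀ μ ∈ W, ∀ s : Fin 5, μ s s = 0)
    (z : Fin 5 → ℂ) (hz : ∀ c, z c ≠ 0)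
    (hY : ∀ μ ∈ W, (fun p q => ∑ r : Fin 5, z r * contractZ μ p q r) ∈ Y) :
    Module.finrank ℂ W ≤ Module.finrank ℂ Y := by
  let sl : (Fin 5 → Fin 5 → Fin 5 → ℂ) →ₗ[ℂ] (Fin 5 → Fin 5 → ℂ) :=
    { toFun := fun T p q => ∑ r : Fin 5, z r * T p q r
      map_add' := fun T T' => by
        funext p q
        simp only [Pi.add_apply, mul_add, Finset.sum_add_distrib]
      map_smul' := fun s T => by
        funext p q
        simp only [Pi.smul_apply, smul_eq_mul, RingHom.id_apply, Finset.mul_sum]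
        exact Finset.sum_congr rfl fun r _ => by ring }
  have hsl : ∀ (T : Fin 5 → Fin 5 → Fin 5 → ℂ), sl T = fun p q => ∑ r : Fin 5, z r * T p q r := fun T => rfl
  let f : W →ₗ[ℂ] Y := LinearMap.codRestrict Y ((sl ∘ₗ cZ).domRestrict W) (fun μ => by
    simpa [hsl, cZ_apply] using hY μ.1 μ.2)
  apply LinearMap.finrank_le_finrank_of_injective (f := f)
  rw [injective_iff_map_eq_zero]
  intro μ hμ
  have h0 : sl (contractZ μ.1) = 0 := by
    have := congrArg Subtype.val hμ
    simpa [f, cZ_apply] using this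
  apply Subtype.ext
  exact eq_zero_of_sliceZ μ.1 (hWs μ.1 μ.2) (hWd μ.1 μ.2) z hz fun p q => by
    have := congrFun (congrFun h0 p) q
    simpa [hsl] using this

/-- ★★ **`(SC)` WHEN `U₁₂` HAS A FULLY SUPPORTED COMMON KERNEL VECTOR**: `finrank W ≤ finrank (U₀₁ ⊔ U₀₂ ⊔ U₁₂)`
(all three spans symmetric, any dimensions, any position). [folklore] -/
theorem finrank_le_of_kernel_vector_12 (U01 U02 U12 W : Submodule ℂ (Fin 5 → Fin 5 → ℂ))
    (h01 : ∀ x ∈ U01, ∀ p q : Fin 5, x p q = x q p) (h02 : ∀ x ∈ U02, ∀ p q : Fin 5, x p q = x q p)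
    (h12 : ∀ x ∈ U12, ∀ p q : Fin 5, x p q = x q p) (z : Fin 5 → ℂ) (hz : ∀ c, z c ≠ 0)
    (hker : ∀ x ∈ U12, ∀ q : Fin 5, (∑ r : Fin 5, x q r * z r) = 0)
    (hWs : ∀ μ ∈ W, ∀ s t : Fin 5, μ s t = μ t s) (hWd : ∀ μ ∈ W, ∀ s : Fin 5, μ s s = 0)
    (hWc : ∀ μ ∈ W, contractZ μ ∈ L3 U01 U02 U12) :
    Module.finrank ℂ W ≤ Module.finrank ℂ (U01 ⊔ U02 ⊔ U12 : Submodule ℂ (Fin 5 → Fin 5 → ℂ)) :=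
  finrank_le_of_sliceZ_mem W _ hWs hWd z hz fun μ hμ => sliceKer_mem_12 U01 U02 U12 h01 h02 h12 z hker μ (hWc μ hμ)

/-- ★★ **`(SC)` WHEN `U₀₂` HAS A FULLY SUPPORTED COMMON KERNEL VECTOR.** [folklore] -/
theorem finrank_le_of_kernel_vector_02 (U01 U02 U12 W : Submodule ℂ (Fin 5 → Fin 5 → ℂ))
    (h01 : ∀ x ∈ U01, ∀ p q : Fin 5, x p q = x q p) (h02 : ∀ x ∈ U02, ∀ p q : Fin 5, x p q = x q p)
    (h12 : ∀ x ∈ U12, ∀ p q : Fin 5, x p q = x q p) (z : Fin 5 → ℂ) (hz : ∀ c, z c ≠ 0)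
    (hker : ∀ x ∈ U02, ∀ q : Fin 5, (∑ r : Fin 5, x q r * z r) = 0)
    (hWs : ∀ μ ∈ W, ∀ s t : Fin 5, μ s t = μ t s) (hWd : ∀ μ ∈ W, ∀ s : Fin 5, μ s s = 0)
    (hWc : ∀ μ ∈ W, contractZ μ ∈ L3 U01 U02 U12) :
    Module.finrank ℂ W ≤ Module.finrank ℂ (U01 ⊔ U02 ⊔ U12 : Submodule ℂ (Fin 5 → Fin 5 → ℂ)) :=
  finrank_le_of_sliceZ_mem W _ hWs hWd z hz fun μ hμ => sliceKer_mem_02 U01 U02 U12 h01 h02 h12 z hker μ (hWc μ hμ)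

/-- ★★ **`(SC)` WHEN `U₀₁` HAS A FULLY SUPPORTED COMMON KERNEL VECTOR.** [folklore] -/
theorem finrank_le_of_kernel_vector_01 (U01 U02 U12 W : Submodule ℂ (Fin 5 → Fin 5 → ℂ))
    (h01 : ∀ x ∈ U01, ∀ p q : Fin 5, x p q = x q p) (h02 : ∀ x ∈ U02, ∀ p q : Fin 5, x p q = x q p)
    (h12 : ∀ x ∈ U12, ∀ p q : Fin 5, x p q = x q p) (z : Fin 5 → ℂ) (hz : ∀ c, z c ≠ 0)
    (hker : ∀ x ∈ U01, ∀ q : Fin 5, (∑ r : Fin 5, x q r * z r) = 0)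
    (hWs : ∀ μ ∈ W, ∀ s t : Fin 5, μ s t = μ t s) (hWd : ∀ μ ∈ W, ∀ s : Fin 5, μ s s = 0)
    (hWc : ∀ μ ∈ W, contractZ μ ∈ L3 U01 U02 U12) :
    Module.finrank ℂ W ≤ Module.finrank ℂ (U01 ⊔ U02 ⊔ U12 : Submodule ℂ (Fin 5 → Fin 5 → ℂ)) :=
  finrank_le_of_sliceZ_mem W _ hWs hWd z hz fun μ hμ => sliceKer_mem_01 U01 U02 U12 h01 h02 h12 z hker μ (hWc μ hμ)

/-- ★★ **`CaptureIneqSym` FOR A SPAN WITH A FULLY SUPPORTED COMMON KERNEL VECTOR** (any one of the three slots). [folklore] -/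
theorem captureIneqSym_of_kernel_vector (U01 U02 U12 W : Submodule ℂ (Fin 5 → Fin 5 → ℂ))
    (h01 : ∀ x ∈ U01, ∀ p q : Fin 5, x p q = x q p) (h02 : ∀ x ∈ U02, ∀ p q : Fin 5, x p q = x q p)
    (h12 : ∀ x ∈ U12, ∀ p q : Fin 5, x p q = x q p) (z : Fin 5 → ℂ) (hz : ∀ c, z c ≠ 0)
    (hker : (∀ x ∈ U01, ∀ q : Fin 5, (∑ r : Fin 5, x q r * z r) = 0) ∨ (∀ x ∈ U02, ∀ q : Fin 5, (∑ r : Fin 5, x q r * z r) = 0) ∨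
      (∀ x ∈ U12, ∀ q : Fin 5, (∑ r : Fin 5, x q r * z r) = 0))
    (hWs : ∀ μ ∈ W, ∀ s t : Fin 5, μ s t = μ t s) (hWd : ∀ μ ∈ W, ∀ s : Fin 5, μ s s = 0)
    (hWc : ∀ μ ∈ W, contractZ μ ∈ L3 U01 U02 U12) :
    Module.finrank ℂ W ≤ Module.finrank ℂ U01 + Module.finrank ℂ U02 + Module.finrank ℂ U12 := by
  have hX : Module.finrank ℂ (U01 ⊔ U02 ⊔ U12 : Submodule ℂ (Fin 5 → Fin 5 → ℂ))
      ≤ Module.finrank ℂ U01 + Module.finrank ℂ U02 + Module.finrank ℂ U12 :=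
    (Submodule.finrank_add_le_finrank_add_finrank _ _).trans
      (Nat.add_le_add_right (Submodule.finrank_add_le_finrank_add_finrank _ _) _)
  rcases hker with hk | hk | hk
  · exact (finrank_le_of_kernel_vector_01 U01 U02 U12 W h01 h02 h12 z hz hk hWs hWd hWc).trans hX
  · exact (finrank_le_of_kernel_vector_02 U01 U02 U12 W h01 h02 h12 z hz hk hWs hWd hWc).trans hX
  · exact (finrank_le_of_kernel_vector_12 U01 U02 U12 W h01 h02 h12 z hz hk hWs hWd hWc).trans hX

end LaplaceFiveSeparatedCapture

end Summit.ValiantsHypothesis.ValiantsHypothesis.Theorems.RigidityForcesSymmetryRankRigidMinimalRepr
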